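import Mathlib
import HarnessLib

/-!
# Route BernsteinTemperature, item `PlanarPressureAM` — file A: the coefficient recurrence

Helper file (supports item `stmt-CriticalPhenomena-10768`). Pure real-sequence algebra, no analysis.

The Taylor coefficients `y m` at `w = 0` of `Y(w) = ₂F₁(½,½;1; 16w(1-w)²/(1+w)⁴)` (the pulled-back
complete elliptic integral that appears in Onsager's square-lattice pressure written in
`w = tanh² β`) satisfy `y 0 = 1, y 1 = 4, y 2 = 12, y 3 = 44, y 4 = 188` and the order-five
P-recurrence `planarPressureAM_Rec`. We prove, for ANY real sequence with these data:

* two-sided ratio bounds `λ (k-2)/(k-1) ≤ y k / y (k-1) ≤ λ k/(k+1)` (`λ = 3 + 2√2`, encoded as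
  `L ^ 2 = 6 L - 1 ∧ 5 ≤ L`), by strong induction with an explicit polynomial certificate;
* hence positivity `0 < y m`, the growth bound `y m ≤ L ^ m`, and the key sign
  `y (m+2) + y m ≤ 6 y (m+1)`, which is the non-negativity of the Taylor coefficients of
  `(1+w)² - (1-6w+w²) Y(w)`.
-/

namespace Summit.CriticalPhenomena.Ising3DConformalLimit.Theorems

/-- Polynomial certificate for the upper ratio bound in the induction step (variable `t = m - 6 ≥ 0`):
after clearing denominators the slack is `∑ᵢ (aᵢ + bᵢ L) tⁱ` with `aᵢ + 5 bᵢ ≥ 0`. [folklore] -/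
theorem planarPressureAM_up_scalar (L t : ℝ) (hL : L ^ 2 = 6 * L - 1) (hL5 : 5 ≤ L)
    (ht : 0 ≤ t) :
    (t + 8) * (L ^ 4 * (t + 1) * (t + 4) * (t + 5) * (5 * (t + 6) ^ 2 + 10 * (t + 6) + 4)
      + L ^ 3 * (t + 1) * (t + 5) ^ 2 * (6 * (t + 6) ^ 2 - 30 * (t + 6) - 4)
      - L ^ 2 * (t + 1) * (t + 4) * (t + 7) * (6 * (t + 6) ^ 2 - 6 * (t + 6) - 40)
      - L * (t + 1) * (t + 5) * (t + 7) * (5 * (t + 6) ^ 2 - 40 * (t + 6) + 79)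
      + (t + 4) * (t + 5) ^ 2 * (t + 2) ^ 2)
    ≤ L ^ 4 * (t + 1) * (t + 4) * (t + 5) * L * (t + 7) ^ 3 := by
  have key : L ^ 4 * (t + 1) * (t + 4) * (t + 5) * L * (t + 7) ^ 3
      - (t + 8) * (L ^ 4 * (t + 1) * (t + 4) * (t + 5) * (5 * (t + 6) ^ 2 + 10 * (t + 6) + 4)
      + L ^ 3 * (t + 1) * (t + 5) ^ 2 * (6 * (t + 6) ^ 2 - 30 * (t + 6) - 4)
      - L ^ 2 * (t + 1) * (t + 4) * (t + 7) * (6 * (t + 6) ^ 2 - 6 * (t + 6) - 40)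
      - L * (t + 1) * (t + 5) * (t + 7) * (5 * (t + 6) ^ 2 - 40 * (t + 6) + 79)
      + (t + 4) * (t + 5) ^ 2 * (t + 2) ^ 2)
      = (-29200 + 161860 * L) + (-43972 + 246404 * L) * t + (-17788 + 99496 * L) * t^2
        + (-2840 + 15844 * L) * t^3 + (-160 + 892 * L) * t^4 := by
    linear_combination (26000 - 540 * L + 2120 * L^2 + 6860 * L^3 + 38292 * t - 3243 * t * L
      + 4634 * t * L^2 + 12887 * t * L^3 + 13800 * t^2 - 4207 * t^2 * L + 3642 * t^2 * L^2
      + 8113 * t^2 * L^3 + 1424 * t^3 - 1826 * t^3 * L + 1370 * t^3 * L^2 + 2442 * t^3 * L^3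
      - 109 * t^4 - 352 * t^4 * L + 267 * t^4 * L^2 + 386 * t^4 * L^3 - 26 * t^5 - 31 * t^5 * L
      + 26 * t^5 * L^2 + 31 * t^5 * L^3 - t^6 - t^6 * L + t^6 * L^2 + t^6 * L^3) * hL
  have h0 : 0 ≤ -29200 + 161860 * L := by linarith
  have h1 : 0 ≤ (-43972 + 246404 * L) * t := mul_nonneg (by linarith) ht
  have h2 : 0 ≤ (-17788 + 99496 * L) * t ^ 2 := mul_nonneg (by linarith) (by positivity)
  have h3 : 0 ≤ (-2840 + 15844 * L) * t ^ 3 := mul_nonneg (by linarith) (by positivity)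
  have h4 : 0 ≤ (-160 + 892 * L) * t ^ 4 := mul_nonneg (by linarith) (by positivity)
  linarith [key, h0, h1, h2, h3, h4]

/-- Polynomial certificate for the lower ratio bound in the induction step (variable `t = m - 6 ≥ 0`).
[folklore] -/
theorem planarPressureAM_lo_scalar (L t : ℝ) (hL : L ^ 2 = 6 * L - 1) (hL5 : 5 ≤ L)
    (ht : 0 ≤ t) :
    L ^ 4 * (t + 6) * (t + 3) * (t + 2) * L * (t + 5) * (t + 7) ^ 2
    ≤ (t + 6) * (L ^ 4 * (t + 6) * (t + 3) * (t + 2) * (5 * (t + 6) ^ 2 + 10 * (t + 6) + 4)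
      + L ^ 3 * (t + 3) * (t + 2) * (t + 7) * (6 * (t + 6) ^ 2 - 30 * (t + 6) - 4)
      - L ^ 2 * (t + 6) * (t + 2) * (t + 5) * (6 * (t + 6) ^ 2 - 6 * (t + 6) - 40)
      - L * (t + 6) * (t + 3) * (t + 5) * (5 * (t + 6) ^ 2 - 40 * (t + 6) + 79)
      + (t + 6) * (t + 2) * (t + 7) * (t + 2) ^ 2) := by
  have key : (t + 6) * (L ^ 4 * (t + 6) * (t + 3) * (t + 2) * (5 * (t + 6) ^ 2 + 10 * (t + 6) + 4)
      + L ^ 3 * (t + 3) * (t + 2) * (t + 7) * (6 * (t + 6) ^ 2 - 30 * (t + 6) - 4)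
      - L ^ 2 * (t + 6) * (t + 2) * (t + 5) * (6 * (t + 6) ^ 2 - 6 * (t + 6) - 40)
      - L * (t + 6) * (t + 3) * (t + 5) * (5 * (t + 6) ^ 2 - 40 * (t + 6) + 79)
      + (t + 6) * (t + 2) * (t + 7) * (t + 2) ^ 2)
      - L ^ 4 * (t + 6) * (t + 3) * (t + 2) * L * (t + 5) * (t + 7) ^ 2
      = (-41328 + 234216 * L) + (-47040 + 265644 * L) * t + (-18356 + 103240 * L) * t^2
        + (-2904 + 16264 * L) * t^3 + (-160 + 892 * L) * t^4 := by
    linear_combination (43344 + 15588 * L - 216 * L^2 - 8820 * L^3 + 51024 * t + 20808 * t * L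
      - 2016 * t * L^2 - 13104 * t * L^3 + 21460 * t^2 + 10667 * t^2 * L - 2370 * t^2 * L^2
      - 7663 * t^2 * L^3 + 4112 * t^3 + 2748 * t^3 * L - 1096 * t^3 * L^2 - 2274 * t^3 * L^3
      + 406 * t^4 + 390 * t^4 * L - 240 * t^4 * L^2 - 364 * t^4 * L^3 + 25 * t^5 + 30 * t^5 * L
      - 25 * t^5 * L^2 - 30 * t^5 * L^3 + t^6 + t^6 * L - t^6 * L^2 - t^6 * L^3) * hL
  have h0 : 0 ≤ -41328 + 234216 * L := by linarith
  have h1 : 0 ≤ (-47040 + 265644 * L) * t := mul_nonneg (by linarith) ht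
  have h2 : 0 ≤ (-18356 + 103240 * L) * t ^ 2 := mul_nonneg (by linarith) (by positivity)
  have h3 : 0 ≤ (-2904 + 16264 * L) * t ^ 3 := mul_nonneg (by linarith) (by positivity)
  have h4 : 0 ≤ (-160 + 892 * L) * t ^ 4 := mul_nonneg (by linarith) (by positivity)
  linarith [key, h0, h1, h2, h3, h4]


/-- Two-sided ratio bounds for any real solution of the recurrence with the hypergeometric
initial data: for every `j`, `0 < y (j+1)`, `L j · y (j+1) ≤ (j+1) · y (j+2)` and
`(j+3) · y (j+2) ≤ L (j+2) · y (j+1)`, where `L = 3 + 2√2` is pinned by `L² = 6L - 1`, `5 ≤ L`.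
Strong induction; the step (from `j+5` on, i.e. index `m = j+6 ≥ 6`) chains the four previous
windows through the recurrence and closes with `planarPressureAM_up_scalar` /
`planarPressureAM_lo_scalar`. [folklore] -/
theorem planarPressureAM_ratio_bounds (y : ℕ → ℝ) (L : ℝ) (hL : L ^ 2 = 6 * L - 1)
    (hL5 : 5 ≤ L) (h0 : y 0 = 1) (h1 : y 1 = 4) (h2 : y 2 = 12) (h3 : y 3 = 44)
    (h4 : y 4 = 188)
    (hrec : ∀ m : ℕ, ((m : ℝ) + 5) ^ 2 * y (m + 5) =
      (5 * ((m : ℝ) + 4) ^ 2 + 10 * ((m : ℝ) + 4) + 4) * y (m + 4)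
      + (6 * ((m : ℝ) + 4) ^ 2 - 30 * ((m : ℝ) + 4) - 4) * y (m + 3)
      - (6 * ((m : ℝ) + 4) ^ 2 - 6 * ((m : ℝ) + 4) - 40) * y (m + 2)
      - (5 * ((m : ℝ) + 4) ^ 2 - 40 * ((m : ℝ) + 4) + 79) * y (m + 1)
      + (m : ℝ) ^ 2 * y m) :
    ∀ j : ℕ, 0 < y (j + 1) ∧ L * j * y (j + 1) ≤ (j + 1) * y (j + 2) ∧
      ((j : ℝ) + 3) * y (j + 2) ≤ L * (j + 2) * y (j + 1) := by
  have hL6 : L < 6 := by nlinarith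
  have hL58 : 29 / 5 ≤ L := by nlinarith
  have hL0 : 0 ≤ L := by linarith
  have h5 : y 5 = 868 := by
    have := hrec 0
    simp only [Nat.cast_zero, zero_add, h0, h1, h2, h3, h4] at this
    linarith
  have h6 : y 6 = 4196 := by
    have := hrec 1
    simp only [Nat.cast_one, h1, h2, h3, h4, h5] at this
    linarith
  intro j
  induction j using Nat.strong_induction_on with
  | _ j ih =>
    rcases j with _ | _ | _ | _ | _ | j
    · push_cast
      simp only [zero_add, h1, h2]
      exact ⟨by norm_num, by linarith, by linarith⟩
    · push_cast
      simp only [h2, h3]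
      exact ⟨by norm_num, by linarith, by linarith⟩
    · push_cast
      simp only [h3, h4]
      exact ⟨by norm_num, by linarith, by linarith⟩
    · push_cast
      simp only [h4, h5]
      exact ⟨by norm_num, by linarith, by linarith⟩
    · push_cast
      simp only [h5, h6]
      exact ⟨by norm_num, by linarith, by linarith⟩
    · -- the step: index m = j + 6, t = j
      set t : ℝ := (j : ℝ) with ht_def
      have ht : 0 ≤ t := Nat.cast_nonneg j
      have hy5 : 0 < y (j + 5) := (ih (j + 4) (by omega)).1
      have hy4 : 0 < y (j + 4) := (ih (j + 3) (by omega)).1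
      have hy3 : 0 < y (j + 3) := (ih (j + 2) (by omega)).1
      have hy2 : 0 < y (j + 2) := (ih (j + 1) (by omega)).1
      have hLm : L * (t + 4) * y (j + 5) ≤ (t + 5) * y (j + 6) := by
        have h := (ih (j + 4) (by omega)).2.1; push_cast at h; linarith
      have hUm : (t + 7) * y (j + 6) ≤ L * (t + 6) * y (j + 5) := by
        have h := (ih (j + 4) (by omega)).2.2; push_cast at h; linarith
      have hLm1 : L * (t + 3) * y (j + 4) ≤ (t + 4) * y (j + 5) := by
        have h := (ih (j + 3) (by omega)).2.1; push_cast at h; linarith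
      have hUm1 : (t + 6) * y (j + 5) ≤ L * (t + 5) * y (j + 4) := by
        have h := (ih (j + 3) (by omega)).2.2; push_cast at h; linarith
      have hLm2 : L * (t + 2) * y (j + 3) ≤ (t + 3) * y (j + 4) := by
        have h := (ih (j + 2) (by omega)).2.1; push_cast at h; linarith
      have hUm2 : (t + 5) * y (j + 4) ≤ L * (t + 4) * y (j + 3) := by
        have h := (ih (j + 2) (by omega)).2.2; push_cast at h; linarith
      have hLm3 : L * (t + 1) * y (j + 2) ≤ (t + 2) * y (j + 3) := by
        have h := (ih (j + 1) (by omega)).2.1; push_cast at h; linarith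
      have hUm3 : (t + 4) * y (j + 3) ≤ L * (t + 3) * y (j + 2) := by
        have h := (ih (j + 1) (by omega)).2.2; push_cast at h; linarith
      have hr : (t + 7) ^ 2 * y (j + 7) =
          (5 * (t + 6) ^ 2 + 10 * (t + 6) + 4) * y (j + 6)
          + (6 * (t + 6) ^ 2 - 30 * (t + 6) - 4) * y (j + 5)
          - (6 * (t + 6) ^ 2 - 6 * (t + 6) - 40) * y (j + 4)
          - (5 * (t + 6) ^ 2 - 40 * (t + 6) + 79) * y (j + 3)
          + (t + 2) ^ 2 * y (j + 2) := by
        have h := hrec (j + 2); push_cast at h; linarith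
      have hB : 0 ≤ 6 * (t + 6) ^ 2 - 30 * (t + 6) - 4 := by
        rw [show 6 * (t + 6) ^ 2 - 30 * (t + 6) - 4 = 6 * t ^ 2 + 42 * t + 32 by ring]; positivity
      have hC : 0 ≤ 6 * (t + 6) ^ 2 - 6 * (t + 6) - 40 := by
        rw [show 6 * (t + 6) ^ 2 - 6 * (t + 6) - 40 = 6 * t ^ 2 + 66 * t + 140 by ring]; positivity
      have hD : 0 ≤ 5 * (t + 6) ^ 2 - 40 * (t + 6) + 79 := by
        rw [show 5 * (t + 6) ^ 2 - 40 * (t + 6) + 79 = 5 * t ^ 2 + 20 * t + 19 by ring]; positivity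
      -- positivity of y (j+6)
      have hy6 : 0 < y (j + 6) := by
        have h' : 0 < (t + 5) * y (j + 6) :=
          (show 0 < L * (t + 4) * y (j + 5) by positivity).trans_le hLm
        exact (mul_pos_iff_of_pos_left (by positivity)).mp h'
      refine ⟨hy6, ?_, ?_⟩
      · -- lower bound: L (t+5) y(j+6) ≤ (t+6) y(j+7)
        have hc2 : L ^ 2 * (t + 3) * y (j + 4) ≤ (t + 5) * y (j + 6) := by
          calc L ^ 2 * (t + 3) * y (j + 4) = L * (L * (t + 3) * y (j + 4)) := by ring
            _ ≤ L * ((t + 4) * y (j + 5)) := mul_le_mul_of_nonneg_left hLm1 hL0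
            _ = L * (t + 4) * y (j + 5) := by ring
            _ ≤ (t + 5) * y (j + 6) := hLm
        have hc3 : L ^ 3 * (t + 2) * y (j + 3) ≤ (t + 5) * y (j + 6) := by
          calc L ^ 3 * (t + 2) * y (j + 3) = L ^ 2 * (L * (t + 2) * y (j + 3)) := by ring
            _ ≤ L ^ 2 * ((t + 3) * y (j + 4)) :=
                mul_le_mul_of_nonneg_left hLm2 (by positivity)
            _ = L ^ 2 * (t + 3) * y (j + 4) := by ring
            _ ≤ (t + 5) * y (j + 6) := hc2
        have hc4 : (t + 7) * y (j + 6) ≤ L ^ 4 * (t + 3) * y (j + 2) := by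
          calc (t + 7) * y (j + 6) ≤ L * (t + 6) * y (j + 5) := hUm
            _ = L * ((t + 6) * y (j + 5)) := by ring
            _ ≤ L * (L * (t + 5) * y (j + 4)) := mul_le_mul_of_nonneg_left hUm1 hL0
            _ = L ^ 2 * ((t + 5) * y (j + 4)) := by ring
            _ ≤ L ^ 2 * (L * (t + 4) * y (j + 3)) :=
                mul_le_mul_of_nonneg_left hUm2 (by positivity)
            _ = L ^ 3 * ((t + 4) * y (j + 3)) := by ring
            _ ≤ L ^ 3 * (L * (t + 3) * y (j + 2)) :=
                mul_le_mul_of_nonneg_left hUm3 (by positivity)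
            _ = L ^ 4 * (t + 3) * y (j + 2) := by ring
        have hp1 := mul_le_mul_of_nonneg_left hUm
          (show (0 : ℝ) ≤ (t + 6) * L ^ 3 * (t + 3) * (t + 2) * (6 * (t + 6) ^ 2 - 30 * (t + 6) - 4)
            by positivity)
        have hp2 := mul_le_mul_of_nonneg_left hc2
          (show (0 : ℝ) ≤ (t + 6) * L ^ 2 * (t + 6) * (t + 2) * (6 * (t + 6) ^ 2 - 6 * (t + 6) - 40)
            by positivity)
        have hp3 := mul_le_mul_of_nonneg_left hc3
          (show (0 : ℝ) ≤ (t + 6) * L * (t + 6) * (t + 3) * (5 * (t + 6) ^ 2 - 40 * (t + 6) + 79)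
            by positivity)
        have hp4 := mul_le_mul_of_nonneg_left hc4
          (show (0 : ℝ) ≤ (t + 6) * (t + 6) * (t + 2) * (t + 2) ^ 2 by positivity)
        have hs := mul_le_mul_of_nonneg_right (planarPressureAM_lo_scalar L t hL hL5 ht) hy6.le
        have key : L ^ 4 * (t + 6) * (t + 3) * (t + 2) * (t + 7) ^ 2 * (L * (t + 5) * y (j + 6))
            ≤ L ^ 4 * (t + 6) * (t + 3) * (t + 2) * (t + 7) ^ 2 * ((t + 6) * y (j + 7)) := by
          linear_combination hp1 + hp2 + hp3 + hp4 + hs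
            - ((t + 6) * (L ^ 4 * (t + 6) * (t + 3) * (t + 2))) * hr
        have fin : L * (t + 5) * y (j + 6) ≤ (t + 6) * y (j + 7) :=
          le_of_mul_le_mul_left key (by positivity)
        push_cast
        linarith [fin]
      · -- upper bound: (t+8) y(j+7) ≤ L (t+7) y(j+6)
        have hb2 : (t + 7) * y (j + 6) ≤ L ^ 2 * (t + 5) * y (j + 4) := by
          calc (t + 7) * y (j + 6) ≤ L * (t + 6) * y (j + 5) := hUm
            _ = L * ((t + 6) * y (j + 5)) := by ring
            _ ≤ L * (L * (t + 5) * y (j + 4)) := mul_le_mul_of_nonneg_left hUm1 hL0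
            _ = L ^ 2 * (t + 5) * y (j + 4) := by ring
        have hb3 : (t + 7) * y (j + 6) ≤ L ^ 3 * (t + 4) * y (j + 3) := by
          calc (t + 7) * y (j + 6) ≤ L ^ 2 * (t + 5) * y (j + 4) := hb2
            _ = L ^ 2 * ((t + 5) * y (j + 4)) := by ring
            _ ≤ L ^ 2 * (L * (t + 4) * y (j + 3)) :=
                mul_le_mul_of_nonneg_left hUm2 (by positivity)
            _ = L ^ 3 * (t + 4) * y (j + 3) := by ring
        have hb4 : L ^ 4 * (t + 1) * y (j + 2) ≤ (t + 5) * y (j + 6) := by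
          calc L ^ 4 * (t + 1) * y (j + 2) = L ^ 3 * (L * (t + 1) * y (j + 2)) := by ring
            _ ≤ L ^ 3 * ((t + 2) * y (j + 3)) :=
                mul_le_mul_of_nonneg_left hLm3 (by positivity)
            _ = L ^ 2 * (L * (t + 2) * y (j + 3)) := by ring
            _ ≤ L ^ 2 * ((t + 3) * y (j + 4)) :=
                mul_le_mul_of_nonneg_left hLm2 (by positivity)
            _ = L * (L * (t + 3) * y (j + 4)) := by ring
            _ ≤ L * ((t + 4) * y (j + 5)) := mul_le_mul_of_nonneg_left hLm1 hL0
            _ = L * (t + 4) * y (j + 5) := by ring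
            _ ≤ (t + 5) * y (j + 6) := hLm
        have hp1 := mul_le_mul_of_nonneg_left hLm
          (show (0 : ℝ) ≤ (t + 8) * L ^ 3 * (t + 1) * (t + 5) * (6 * (t + 6) ^ 2 - 30 * (t + 6) - 4)
            by positivity)
        have hp2 := mul_le_mul_of_nonneg_left hb2
          (show (0 : ℝ) ≤ (t + 8) * L ^ 2 * (t + 1) * (t + 4) * (6 * (t + 6) ^ 2 - 6 * (t + 6) - 40)
            by positivity)
        have hp3 := mul_le_mul_of_nonneg_left hb3
          (show (0 : ℝ) ≤ (t + 8) * L * (t + 1) * (t + 5) * (5 * (t + 6) ^ 2 - 40 * (t + 6) + 79)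
            by positivity)
        have hp4 := mul_le_mul_of_nonneg_left hb4
          (show (0 : ℝ) ≤ (t + 8) * (t + 4) * (t + 5) * (t + 2) ^ 2 by positivity)
        have hs := mul_le_mul_of_nonneg_right (planarPressureAM_up_scalar L t hL hL5 ht) hy6.le
        have key : L ^ 4 * (t + 1) * (t + 4) * (t + 5) * (t + 7) ^ 2 * ((t + 8) * y (j + 7))
            ≤ L ^ 4 * (t + 1) * (t + 4) * (t + 5) * (t + 7) ^ 2 * (L * (t + 7) * y (j + 6)) := by
          linear_combination hp1 + hp2 + hp3 + hp4 + hs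
            + ((t + 8) * (L ^ 4 * (t + 1) * (t + 4) * (t + 5))) * hr
        have fin : (t + 8) * y (j + 7) ≤ L * (t + 7) * y (j + 6) :=
          le_of_mul_le_mul_left key (by positivity)
        push_cast
        linarith [fin]


/-- Positivity of every solution with the hypergeometric initial data. [folklore] -/
theorem planarPressureAM_seq_pos (y : ℕ → ℝ) (L : ℝ) (hL : L ^ 2 = 6 * L - 1)
    (hL5 : 5 ≤ L) (h0 : y 0 = 1) (h1 : y 1 = 4) (h2 : y 2 = 12) (h3 : y 3 = 44)
    (h4 : y 4 = 188)
    (hrec : ∀ m : ℕ, ((m : ℝ) + 5) ^ 2 * y (m + 5) =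
      (5 * ((m : ℝ) + 4) ^ 2 + 10 * ((m : ℝ) + 4) + 4) * y (m + 4)
      + (6 * ((m : ℝ) + 4) ^ 2 - 30 * ((m : ℝ) + 4) - 4) * y (m + 3)
      - (6 * ((m : ℝ) + 4) ^ 2 - 6 * ((m : ℝ) + 4) - 40) * y (m + 2)
      - (5 * ((m : ℝ) + 4) ^ 2 - 40 * ((m : ℝ) + 4) + 79) * y (m + 1)
      + (m : ℝ) ^ 2 * y m) :
    ∀ m : ℕ, 0 < y m := by
  intro m
  rcases m with _ | m
  · rw [h0]; norm_num
  · exact (planarPressureAM_ratio_bounds y L hL hL5 h0 h1 h2 h3 h4 hrec m).1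

/-- Geometric growth bound `y m ≤ L ^ m` (`L = 3 + 2√2 = 1 / w_c`). [folklore] -/
theorem planarPressureAM_seq_le_pow (y : ℕ → ℝ) (L : ℝ) (hL : L ^ 2 = 6 * L - 1)
    (hL5 : 5 ≤ L) (h0 : y 0 = 1) (h1 : y 1 = 4) (h2 : y 2 = 12) (h3 : y 3 = 44)
    (h4 : y 4 = 188)
    (hrec : ∀ m : ℕ, ((m : ℝ) + 5) ^ 2 * y (m + 5) =
      (5 * ((m : ℝ) + 4) ^ 2 + 10 * ((m : ℝ) + 4) + 4) * y (m + 4)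
      + (6 * ((m : ℝ) + 4) ^ 2 - 30 * ((m : ℝ) + 4) - 4) * y (m + 3)
      - (6 * ((m : ℝ) + 4) ^ 2 - 6 * ((m : ℝ) + 4) - 40) * y (m + 2)
      - (5 * ((m : ℝ) + 4) ^ 2 - 40 * ((m : ℝ) + 4) + 79) * y (m + 1)
      + (m : ℝ) ^ 2 * y m) :
    ∀ m : ℕ, y m ≤ L ^ m := by
  have hL0 : 0 ≤ L := by linarith
  intro m
  induction m with
  | zero => simp [h0]
  | succ m ih =>
    rcases m with _ | m
    · rw [h1]; norm_num; linarith
    · -- y (m+2) ≤ L (m+2)/(m+3) · y (m+1) ≤ L · y (m+1) ≤ L · L^(m+1)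
      obtain ⟨hpos, -, hU⟩ := planarPressureAM_ratio_bounds y L hL hL5 h0 h1 h2 h3 h4 hrec m
      have hm : (0 : ℝ) ≤ m := Nat.cast_nonneg m
      have h' : ((m : ℝ) + 3) * y (m + 2) ≤ ((m : ℝ) + 3) * (L * y (m + 1)) := by
        nlinarith [mul_nonneg hL0 hpos.le]
      have h'' : y (m + 2) ≤ L * y (m + 1) := le_of_mul_le_mul_left h' (by positivity)
      calc y (m + 2) ≤ L * y (m + 1) := h''
        _ ≤ L * L ^ (m + 1) := mul_le_mul_of_nonneg_left ih hL0
        _ = L ^ (m + 1 + 1) := by ring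

/-- The key sign: `y (m+2) + y m ≤ 6 · y (m+1)` for all `m`, i.e. the Taylor coefficients of
`(1 + w)² - (1 - 6w + w²) · Y(w)` are non-negative. For `m ≥ 2` it follows from the upper ratio
bound at `m+2` and the lower one at `m+1` (`λ k/(k+1) + (k-2)/(λ (k-3)) ≤ 6` iff `k ≥ 3.12`);
`m = 0, 1` are checked on the initial data. [folklore] -/
theorem planarPressureAM_seq_convex (y : ℕ → ℝ) (L : ℝ) (hL : L ^ 2 = 6 * L - 1)
    (hL5 : 5 ≤ L) (h0 : y 0 = 1) (h1 : y 1 = 4) (h2 : y 2 = 12) (h3 : y 3 = 44)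
    (h4 : y 4 = 188)
    (hrec : ∀ m : ℕ, ((m : ℝ) + 5) ^ 2 * y (m + 5) =
      (5 * ((m : ℝ) + 4) ^ 2 + 10 * ((m : ℝ) + 4) + 4) * y (m + 4)
      + (6 * ((m : ℝ) + 4) ^ 2 - 30 * ((m : ℝ) + 4) - 4) * y (m + 3)
      - (6 * ((m : ℝ) + 4) ^ 2 - 6 * ((m : ℝ) + 4) - 40) * y (m + 2)
      - (5 * ((m : ℝ) + 4) ^ 2 - 40 * ((m : ℝ) + 4) + 79) * y (m + 1)
      + (m : ℝ) ^ 2 * y m) :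
    ∀ m : ℕ, y (m + 2) + y m ≤ 6 * y (m + 1) := by
  have hL0 : 0 ≤ L := by linarith
  intro m
  rcases m with _ | _ | i
  · rw [h0, h1, h2]; norm_num
  · rw [h1, h2, h3]; norm_num
  · obtain ⟨hpos3, -, hU⟩ := planarPressureAM_ratio_bounds y L hL hL5 h0 h1 h2 h3 h4 hrec (i + 2)
    obtain ⟨-, hL', -⟩ := planarPressureAM_ratio_bounds y L hL hL5 h0 h1 h2 h3 h4 hrec (i + 1)
    push_cast at hU hL' ⊢
    have hi : (0 : ℝ) ≤ i := Nat.cast_nonneg i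
    have hp1 := mul_le_mul_of_nonneg_left hU (show (0 : ℝ) ≤ L * (i + 1) by positivity)
    have hp2 := mul_le_mul_of_nonneg_left hL' (show (0 : ℝ) ≤ (i : ℝ) + 5 by positivity)
    have hs : (L ^ 2 * (i + 1) * (i + 4) + (i + 2) * (i + 5)) * y (i + 3)
        ≤ 6 * L * (i + 1) * (i + 5) * y (i + 3) := by
      apply mul_le_mul_of_nonneg_right _ hpos3.le
      have haux : 0 ≤ (6 * L - 2) * (i : ℝ) + (6 * L - 6) := by
        have := mul_nonneg (show (0 : ℝ) ≤ 6 * L - 2 by linarith) hi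
        linarith
      rw [hL]
      linarith [haux]
    have key : L * (i + 1) * (i + 5) * (y (i + 4) + y (i + 2))
        ≤ L * (i + 1) * (i + 5) * (6 * y (i + 3)) := by
      linear_combination hp1 + hp2 + hs
    exact le_of_mul_le_mul_left key (by positivity)

end Summit.CriticalPhenomena.Ising3DConformalLimit.Theorems
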